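import Mathlib.Data.List.Infix
import Mathlib.Data.List.Flatten
import Mathlib.Data.List.Count
import Mathlib.Data.Nat.Find
import Mathlib.Data.Fintype.Pi
import Mathlib.Data.Fintype.Card
import Mathlib.Data.Fintype.BigOperators
import Mathlib.Data.Finset.Sort
import Mathlib.Data.Finset.Powerset
import Mathlib.Data.Finset.Max
import Mathlib.Algebra.Group.Action.Defs
import Mathlib.Algebra.Order.BigOperators.Group.List
import Mathlib.Tactic.Ring
import Mathlib.Tactic.Linarith
import Literature.Combinatorics.SimpleGraph.RamseyMulticolour
import HarnessLib

/-!
# Repetitive mappings (Lothaire 1997, §4.1)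

A transcription of §4.1 ("Repetitive mappings") of Chapter 4 (*Repetitive mappings and morphisms*,
by G. Pirillo) of M. Lothaire, *Combinatorics on Words* (Cambridge Mathematical Library, 1997),
pp. 50–52.

Given a map `φ : A⁺ → E`, a word `w` is a *`k`-th power modulo `φ`* if `w = w₁ w₂ ⋯ w_k`
with nonempty *components* `wᵢ` and `φ(w₁) = ⋯ = φ(w_k)`; it is *uniform* if moreover
`|w₁| = ⋯ = |w_k|`.  A word *contains* a `k`-th power modulo `φ` if one of its factors is one,
and `φ` is *repetitive* (*uniformly repetitive*) if for each `k` every long enough word contains a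
(uniform) `k`-th power modulo `φ`.

* **Theorem 4.1.1**: a map from `A⁺` to a FINITE set `E`, `Card(E) = n`, is repetitive; precisely
  (the book's proof, p. 51) every word of length `kⁿ` contains a `k`-th power modulo `φ`.  The
  proof is the book's: the vector `τ(u) = (i₁, …, i_n)`, `i_j = max {l | u ∈ A* B_j^l}`
  (`B_j = φ⁻¹(j)`), takes distinct values on the `kⁿ + 1` left factors of `w`, so some
  `i_j ≥ k`.
* **Example 4.1.2**: the bound `kⁿ` is optimal — the words `w₁ = a₁^{k-1}`,
  `wᵢ = (w_{i-1} aᵢ)^{k-1} w_{i-1}` have length `kⁿ - 1` and contain no `k`-th power modulo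
  `φ(w) = max {i | aᵢ ∈ alph(w)}`; proved here in general (letters `aᵢ = i ∈ ℕ`,
  `w₀ = ε`).

Conventions: `A⁺ → E` is modelled by a function `φ : List α → E` on all words, only ever
applied to nonempty components.  "Each word of length `l` contains …" is stated for words of length
`≥ l` (equivalent, a word of length `≥ l` having a factor of length `l`).

* **Theorem 4.1.3** (Ramsey) is stated WITHOUT proof in the text (which refers to Ramsey,
  Graham–Rothschild and Graham–Rothschild–Spencer 1980); here the general statement is a
  `Prop`-valued definition (`IsRamseyBound`, `RamseyTheorem`) and the pair form `IsRamseyPairBound`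
  enters **Theorem 4.1.4** as a hypothesis `hR`: every word of length `R(2, k+1, n)` has a factor
  `w₁ ⋯ w_k` all of whose products `wᵢ ⋯ w_{i'}` have the same `φ`-value (book's proof via a
  monochromatic set of cut points).  The case actually used, `r = 2` (pairs), IS a theorem of the
  tree — the multicolour Ramsey theorem for graphs
  `Literature.Combinatorics.SimpleGraph.ramseyMulticolour_finset` (Graham–Rothschild–Spencer 1990,
  §1.2) — so `hR` is discharged (`exists_isRamseyPairBound`) and Theorem 4.1.4 and the second proof
  of Theorem 4.1.1 "deduced from Ramsey's theorem" announced in §4.0 are also given unconditionally.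

NOT transcribed here: a proof of Ramsey's theorem for `r`-subsets, `r ≥ 3`; §4.2 (repetitive
morphisms, Theorems 4.2.1–4.2.2, which use van der Waerden's theorem) and §4.3.
-/

namespace Literature.Combinatorics.Words

variable {α E : Type*}

/-! ### Definitions (p. 51) -/

/-- `w` is a **`k`-th power modulo `φ`**: `w = w₁ ⋯ w_k`, `wᵢ ∈ A⁺`,
`φ(w₁) = ⋯ = φ(w_k)` (the `wᵢ` are the *components*). [cite: Lothaire1997, §4.1 (p. 51)] -/
def IsPowerMod (φ : List α → E) (k : ℕ) (w : List α) : Prop :=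
  ∃ ws : List (List α), ws.length = k ∧ (∀ x ∈ ws, x ≠ []) ∧ ws.flatten = w ∧
    ∀ x ∈ ws, ∀ y ∈ ws, φ x = φ y

/-- A **uniform** `k`-th power modulo `φ`: in addition `|w₁| = ⋯ = |w_k|`.
[cite: Lothaire1997, §4.1 (p. 51)] -/
def IsUniformPowerMod (φ : List α → E) (k : ℕ) (w : List α) : Prop :=
  ∃ ws : List (List α), ws.length = k ∧ (∀ x ∈ ws, x ≠ []) ∧ ws.flatten = w ∧
    (∀ x ∈ ws, ∀ y ∈ ws, φ x = φ y) ∧ ∀ x ∈ ws, ∀ y ∈ ws, x.length = y.length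

/-- `w` **contains** a `k`-th power modulo `φ`: some factor of `w` is one.
[cite: Lothaire1997, §4.1 (p. 51)] -/
def ContainsPowerMod (φ : List α → E) (k : ℕ) (w : List α) : Prop :=
  ∃ v : List α, v <:+: w ∧ IsPowerMod φ k v

/-- `w` contains a uniform `k`-th power modulo `φ`. [cite: Lothaire1997, §4.1 (p. 51)] -/
def ContainsUniformPowerMod (φ : List α → E) (k : ℕ) (w : List α) : Prop :=
  ∃ v : List α, v <:+: w ∧ IsUniformPowerMod φ k v

/-- `φ` is **repetitive**: for each `k` there is `l` such that every word of length (at least) `l`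
contains a `k`-th power modulo `φ`. [cite: Lothaire1997, §4.1 (p. 51)] -/
def IsRepetitive (φ : List α → E) : Prop :=
  ∀ k : ℕ, ∃ l : ℕ, ∀ w : List α, l ≤ w.length → ContainsPowerMod φ k w

/-- `φ` is **uniformly repetitive**. [cite: Lothaire1997, §4.1 (p. 51)] -/
def IsUniformlyRepetitive (φ : List α → E) : Prop :=
  ∀ k : ℕ, ∃ l : ℕ, ∀ w : List α, l ≤ w.length → ContainsUniformPowerMod φ k w

/-- A uniform `k`-th power modulo `φ` is a `k`-th power modulo `φ`.
[cite: Lothaire1997, §4.1 (p. 51)] -/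
theorem IsUniformPowerMod.isPowerMod {φ : List α → E} {k : ℕ} {w : List α}
    (h : IsUniformPowerMod φ k w) : IsPowerMod φ k w := by
  obtain ⟨ws, h1, h2, h3, h4, -⟩ := h
  exact ⟨ws, h1, h2, h3, h4⟩

/-- Uniformly repetitive maps are repetitive. [cite: Lothaire1997, §4.1 (p. 51)] -/
theorem IsUniformlyRepetitive.isRepetitive {φ : List α → E} (h : IsUniformlyRepetitive φ) :
    IsRepetitive φ := by
  intro k
  obtain ⟨l, hl⟩ := h k
  refine ⟨l, fun w hw => ?_⟩
  obtain ⟨v, hv, hp⟩ := hl w hw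
  exact ⟨v, hv, hp.isPowerMod⟩

/-- Containing a `k`-th power modulo `φ` is inherited from factors.
[cite: Lothaire1997, §4.1 (p. 51)] -/
theorem ContainsPowerMod.of_infix {φ : List α → E} {k : ℕ} {v w : List α}
    (h : ContainsPowerMod φ k v) (hvw : v <:+: w) : ContainsPowerMod φ k w := by
  obtain ⟨u, hu, hp⟩ := h
  exact ⟨u, hu.trans hvw, hp⟩

/-! ### Theorem 4.1.1 — the book's proof via `τ` -/

section Tau

variable (φ : List α → E)

/-- `u ∈ A* B_j^l` (`B_j = φ⁻¹(j)`): `u` ends with `l` consecutive nonempty factors of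
`φ`-value `j`. [cite: Lothaire1997, Theorem 4.1.1 (proof, p. 51)] -/
def PowTail (j : E) (u : List α) (l : ℕ) : Prop :=
  ∃ us : List (List α),
    us.length = l ∧ (∀ x ∈ us, x ≠ [] ∧ φ x = j) ∧ us.flatten <:+ u

variable {φ}

/-- `u ∈ A* B_j^0` always. [cite: Lothaire1997, Theorem 4.1.1 (proof, p. 51)] -/
theorem powTail_zero (j : E) (u : List α) : PowTail φ j u 0 :=
  ⟨[], rfl, by simp, by simp⟩

/-- [folklore] A flattened list of nonempty words is at least as long as the number of words
(used in the proof of Theorem 4.1.1, p. 51, and in Example 4.1.2). -/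
private theorem length_le_length_flatten_of_ne_nil {us : List (List α)} (h : ∀ x ∈ us, x ≠ []) :
    us.length ≤ us.flatten.length := by
  induction us with
  | nil => simp
  | cons x us ih =>
    have hx : x ≠ [] := h x (by simp)
    have hx' : 1 ≤ x.length := by
      cases x with
      | nil => exact absurd rfl hx
      | cons a x => simp
    simp only [List.length_cons, List.flatten_cons, List.length_append]
    have := ih fun y hy => h y (by simp [hy])
    omega

/-- `u ∈ A* B_j^l` forces `l ≤ |u|`. [cite: Lothaire1997, Theorem 4.1.1 (proof, p. 51)] -/
theorem PowTail.le_length {j : E} {u : List α} {l : ℕ} (h : PowTail φ j u l) :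
    l ≤ u.length := by
  obtain ⟨us, rfl, hus, hsuf⟩ := h
  exact (length_le_length_flatten_of_ne_nil fun x hx => (hus x hx).1).trans hsuf.length_le

/-- `A* B_j^{l'} ⊆ A* B_j^l` for `l ≤ l'` (drop leading factors).
[cite: Lothaire1997, Theorem 4.1.1 (proof, p. 51)] -/
theorem PowTail.mono {j : E} {u : List α} {l l' : ℕ} (h : PowTail φ j u l') (hl : l ≤ l') :
    PowTail φ j u l := by
  obtain ⟨us, rfl, hus, hsuf⟩ := h
  refine ⟨us.drop (us.length - l), by simp; omega, fun x hx => hus x (List.mem_of_mem_drop hx),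
    ?_⟩
  have hsplit : (us.take (us.length - l)).flatten ++ (us.drop (us.length - l)).flatten =
      us.flatten := by
    rw [← List.flatten_append, List.take_append_drop]
  exact List.IsSuffix.trans ⟨_, hsplit⟩ hsuf

/-- If `u ∈ A* B_j^l` and `z ∈ B_j` then `uz ∈ A* B_j^{l+1}` (p. 51).
[cite: Lothaire1997, Theorem 4.1.1 (proof, p. 51)] -/
theorem PowTail.append {j : E} {u : List α} {l : ℕ} (h : PowTail φ j u l) {z : List α}
    (hz : z ≠ []) (hφ : φ z = j) : PowTail φ j (u ++ z) (l + 1) := by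
  obtain ⟨us, rfl, hus, t, ht⟩ := h
  refine ⟨us ++ [z], by simp, fun x hx => ?_, t, ?_⟩
  · rcases List.mem_append.1 hx with hx | hx
    · exact hus x hx
    · simp only [List.mem_singleton] at hx
      exact ⟨hx ▸ hz, hx ▸ hφ⟩
  · rw [List.flatten_append, List.flatten_singleton, ← List.append_assoc, ht]

open scoped Classical in
/-- The `j`-th component of the book's `τ(u)`: `i_j = max {l | u ∈ A* B_j^l}` (a maximum over
`l ≤ |u|`). [cite: Lothaire1997, Theorem 4.1.1 (proof, p. 51)] -/
noncomputable def maxPowTail (φ : List α → E) (u : List α) (j : E) : ℕ :=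
  Nat.findGreatest (PowTail φ j u) u.length

/-- `u ∈ A* B_j^{τ(u)_j}`. [cite: Lothaire1997, Theorem 4.1.1 (proof, p. 51)] -/
theorem powTail_maxPowTail (u : List α) (j : E) : PowTail φ j u (maxPowTail φ u j) := by
  classical
  exact Nat.findGreatest_spec (P := PowTail φ j u) (Nat.zero_le _) (powTail_zero j u)

/-- Maximality of `τ(u)_j`. [cite: Lothaire1997, Theorem 4.1.1 (proof, p. 51)] -/
theorem le_maxPowTail {u : List α} {j : E} {l : ℕ} (h : PowTail φ j u l) :
    l ≤ maxPowTail φ u j := by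
  classical
  exact Nat.le_findGreatest h.le_length h

/-- The key step of p. 51: if `v = uz` with `z ∈ A⁺` and `j = φ(z)`, the `j`-th component of
`τ(u)` is strictly less than that of `τ(v)`. [cite: Lothaire1997, Theorem 4.1.1 (proof, p. 51)] -/
theorem maxPowTail_lt_maxPowTail_append (u : List α) {z : List α} (hz : z ≠ []) :
    maxPowTail φ u (φ z) < maxPowTail φ (u ++ z) (φ z) :=
  Nat.lt_of_succ_le (le_maxPowTail ((powTail_maxPowTail u (φ z)).append hz rfl))

/-- Hence `τ` is injective on the left factors of a word: `τ(w(1..i)) ≠ τ(w(1..i'))` for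
`i < i' ≤ |w|`. [cite: Lothaire1997, Theorem 4.1.1 (proof, p. 51)] -/
theorem maxPowTail_take_ne (w : List α) {i i' : ℕ} (hii' : i < i') (hi' : i' ≤ w.length) :
    maxPowTail φ (w.take i) ≠ maxPowTail φ (w.take i') := by
  intro h
  set z := (w.drop i).take (i' - i) with hz
  have hz' : z ≠ [] := by
    intro h0
    have : z.length = i' - i := by
      rw [hz, List.length_take, List.length_drop]
      omega
    rw [h0] at this
    simp at this
    omega
  have hsplit : w.take i' = w.take i ++ z := by
    rw [hz, ← List.take_add]
    congr 1
    omega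
  have hlt := maxPowTail_lt_maxPowTail_append (φ := φ) (w.take i) hz'
  rw [← hsplit, ← h] at hlt
  exact lt_irrefl _ hlt

/-- **Theorem 4.1.1** (quantitative form of the book's proof): if `E` is finite with `n` elements,
every word of length at least `kⁿ` contains a `k`-th power modulo `φ`.
[cite: Lothaire1997, Theorem 4.1.1] -/
theorem containsPowerMod_of_pow_card_le_length [Fintype E] (φ : List α → E) (k : ℕ)
    (w : List α) (hw : k ^ Fintype.card E ≤ w.length) : ContainsPowerMod φ k w := by
  classical
  -- some left factor `w(1..i)`, `i ≤ kⁿ`, lies in `A* B_j^k` for some `j`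
  have hex : ∃ i ≤ k ^ Fintype.card E, ∃ j : E, k ≤ maxPowTail φ (w.take i) j := by
    by_contra hcon
    push Not at hcon
    -- otherwise `τ` maps the `kⁿ + 1` left factors injectively into `{0, …, k-1}ⁿ`
    let f : Fin (k ^ Fintype.card E + 1) → (E → Fin k) :=
      fun i j => ⟨maxPowTail φ (w.take i) j, hcon i (Nat.le_of_lt_succ i.2) j⟩
    have hf : Function.Injective f := by
      intro i i' hii'
      have htau : maxPowTail φ (w.take i) = maxPowTail φ (w.take i') := by
        funext j
        have := congr_fun hii' j
        simpa [f] using this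
      by_contra hne
      rcases Nat.lt_or_gt_of_ne (fun h => hne (Fin.ext h)) with hlt | hlt
      · exact maxPowTail_take_ne w hlt ((Nat.le_of_lt_succ i'.2).trans hw) htau
      · exact maxPowTail_take_ne w hlt ((Nat.le_of_lt_succ i.2).trans hw) htau.symm
    have hcard := Fintype.card_le_of_injective f hf
    rw [Fintype.card_fin, Fintype.card_fun, Fintype.card_fin] at hcard
    omega
  obtain ⟨i, -, j, hk⟩ := hex
  obtain ⟨us, hlen, hus, hsuf⟩ := (powTail_maxPowTail (φ := φ) (w.take i) j).mono hk
  refine ⟨us.flatten, hsuf.isInfix.trans (List.take_prefix i w).isInfix, us, hlen,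
    fun x hx => (hus x hx).1, rfl, fun x hx y hy => ?_⟩
  rw [(hus x hx).2, (hus y hy).2]

/-- **Theorem 4.1.1**: a mapping `φ : A⁺ → E` from `A⁺` to a finite set is repetitive.
[cite: Lothaire1997, Theorem 4.1.1] -/
theorem isRepetitive_of_finite [Finite E] (φ : List α → E) : IsRepetitive φ := by
  have := Fintype.ofFinite E
  exact fun k =>
    ⟨k ^ Fintype.card E, fun w hw => containsPowerMod_of_pow_card_le_length φ k w hw⟩

end Tau

/-! ### Theorems 4.1.3 (Ramsey, as a hypothesis) and 4.1.4 -/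

section Ramsey

/-- The content of **Theorem 4.1.3** (Ramsey) for given parameters: every `n`-colouring
(`E`-valued, `Card E = n`) of the `r`-subsets of a set `X ⊆ ℕ` with at least `R` elements has a
`k`-subset `Y ⊆ X` all of whose `r`-subsets get the same colour.  Ramsey's theorem — stated
WITHOUT proof in the text — says such an `R = R(r, k, n)` exists for `k ≥ r ≥ 1`; here it enters
only as a hypothesis. [cite: Lothaire1997, Theorem 4.1.3 (Ramsey; stated without proof)] -/
def IsRamseyBound (r k : ℕ) (E : Type*) (R : ℕ) : Prop :=
  ∀ X : Finset ℕ, R ≤ X.card → ∀ c : Finset ℕ → E,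
    ∃ Y ⊆ X, Y.card = k ∧ ∃ e : E, ∀ Z ∈ Y.powersetCard r, c Z = e

/-- **Theorem 4.1.3** (Ramsey) as a statement: `R(r, k, n)` exists for all `k ≥ r ≥ 1` and `n`
blocks. (Not proved in the text — which refers to Ramsey's paper, Graham–Rothschild and
Graham–Rothschild–Spencer 1980 — nor here.) [cite: Lothaire1997, Theorem 4.1.3 (Ramsey; stated
without proof)] -/
def RamseyTheorem : Prop :=
  ∀ r k n : ℕ, 1 ≤ r → r ≤ k → ∃ R : ℕ, IsRamseyBound r k (Fin n) R

/-- The case `r = 2` used in Theorem 4.1.4, with the colouring of a pair `{i < j}` given as a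
function of `(i, j)`. [cite: Lothaire1997, Theorem 4.1.3 (Ramsey; stated without proof)] -/
def IsRamseyPairBound (k : ℕ) (E : Type*) (R : ℕ) : Prop :=
  ∀ X : Finset ℕ, R ≤ X.card → ∀ c : ℕ → ℕ → E,
    ∃ Y ⊆ X, Y.card = k ∧ ∃ e : E, ∀ i ∈ Y, ∀ j ∈ Y, i < j → c i j = e

/-- `R(2, k, n)` in the set form gives the pair form.
[cite: Lothaire1997, Theorem 4.1.3 (Ramsey; stated without proof)] -/
theorem IsRamseyBound.pair {k : ℕ} {E : Type*} {R : ℕ} (h : IsRamseyBound 2 k E R) :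
    IsRamseyPairBound k E R := by
  intro X hX c
  classical
  let c' : Finset ℕ → E := fun Z => if hZ : Z.Nonempty then c (Z.min' hZ) (Z.max' hZ) else c 0 0
  obtain ⟨Y, hYX, hYk, e, he⟩ := h X hX c'
  refine ⟨Y, hYX, hYk, e, fun i hi j hj hij => ?_⟩
  have hZ : ({i, j} : Finset ℕ) ∈ Y.powersetCard 2 := by
    rw [Finset.mem_powersetCard]
    refine ⟨?_, Finset.card_pair hij.ne⟩
    intro x hx
    simp only [Finset.mem_insert, Finset.mem_singleton] at hx
    rcases hx with rfl | rfl <;> assumption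
  have hne : ({i, j} : Finset ℕ).Nonempty := ⟨i, by simp⟩
  have hmin : ({i, j} : Finset ℕ).min' hne = i :=
    le_antisymm (Finset.min'_le _ _ (by simp))
      (Finset.le_min' _ _ _ fun x hx => by
        simp only [Finset.mem_insert, Finset.mem_singleton] at hx; omega)
  have hmax : ({i, j} : Finset ℕ).max' hne = j :=
    le_antisymm (Finset.max'_le _ _ _ fun x hx => by
        simp only [Finset.mem_insert, Finset.mem_singleton] at hx; omega)
      (Finset.le_max' _ _ (by simp))
  have := he _ hZ
  simp only [c', dif_pos hne, hmin, hmax] at this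
  exact this

/-- **Theorem 4.1.3 for pairs (`r = 2`), proved**: for a finite set `E` and every `k` there is an
integer `R` (an `R(2, k, Card E)`) with `IsRamseyPairBound k E R`.  The text states Ramsey's theorem
without proof; the pairs case is the multicolour Ramsey theorem for graphs formalised in the tree,
`Literature.Combinatorics.SimpleGraph.ramseyMulticolour_finset` (Graham–Rothschild–Spencer, *Ramsey
Theory*, §1.2), transported along `E ≃ Fin (Card E)` and from unordered pairs `s(i, j)` to ordered
pairs `i < j`. [cite: Lothaire1997, Theorem 4.1.3 (Ramsey; the case r = 2)]
[cite: GrahamRothschildSpencer1990, §1.2 (Ramsey's theorem, r colours)] -/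
theorem exists_isRamseyPairBound (k : ℕ) (E : Type*) [Finite E] :
    ∃ R : ℕ, IsRamseyPairBound k E R := by
  classical
  haveI := Fintype.ofFinite E
  obtain ⟨M, hM⟩ :=
    Literature.Combinatorics.SimpleGraph.ramseyMulticolour_finset (Fintype.card E) k
  refine ⟨M, fun X hX c => ?_⟩
  let e : E ≃ Fin (Fintype.card E) := Fintype.equivFin E
  -- the (symmetric) colouring of an unordered pair `{i, j}` by `φ`-colour of the ordered pair
  let c' : Sym2 ℕ → Fin (Fintype.card E) :=
    Sym2.lift ⟨fun i j => e (c (min i j) (max i j)), fun i j => by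
      simp only [min_comm i j, max_comm i j]⟩
  obtain ⟨Y, hYX, hYk, i, hi⟩ := hM X hX c'
  refine ⟨Y, hYX, hYk, e.symm i, fun a ha b hb hab => ?_⟩
  have h := hi a ha b hb hab.ne
  simp only [c', Sym2.lift_mk, min_eq_left hab.le, max_eq_right hab.le] at h
  rw [← h, Equiv.symm_apply_apply]

variable (w : List α) in
/-- The consecutive factors `w(p₁, p₂ - 1), w(p₂, p₃ - 1), …` cut out of `w` by an increasing list
of (0-indexed) cut points `p₁ < p₂ < ⋯`. [cite: Lothaire1997, Theorem 4.1.4 (proof, p. 52)] -/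
def cutFactors : List ℕ → List (List α)
  | p :: q :: ps => (w.drop p).take (q - p) :: cutFactors (q :: ps)
  | _ => []

/-- The number of cut factors. [cite: Lothaire1997, Theorem 4.1.4 (proof, p. 52)] -/
theorem length_cutFactors (w : List α) : ∀ ps : List ℕ, (cutFactors w ps).length = ps.length - 1
  | [] => rfl
  | [_] => rfl
  | p :: q :: ps => by
    simp only [cutFactors, List.length_cons, length_cutFactors w (q :: ps)]
    omega

/-- Dropping cut factors = dropping cut points.
[cite: Lothaire1997, Theorem 4.1.4 (proof, p. 52)] -/
theorem cutFactors_drop (w : List α) : ∀ (ps : List ℕ) (i : ℕ),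
    (cutFactors w ps).drop i = cutFactors w (ps.drop i)
  | ps, 0 => by simp
  | [], i + 1 => by simp [cutFactors]
  | [p], i + 1 => by simp [cutFactors]
  | p :: q :: ps, i + 1 => by
    simp only [cutFactors, List.drop_succ_cons]
    exact cutFactors_drop w (q :: ps) i

/-- Taking cut factors = taking cut points.
[cite: Lothaire1997, Theorem 4.1.4 (proof, p. 52)] -/
theorem cutFactors_take (w : List α) : ∀ (ps : List ℕ) (m : ℕ),
    (cutFactors w ps).take m = cutFactors w (ps.take (m + 1))
  | [], m => by simp [cutFactors]
  | [p], m => by simp [cutFactors]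
  | p :: q :: ps, 0 => by simp [cutFactors]
  | p :: q :: ps, m + 1 => by
    simp only [cutFactors, List.take_succ_cons, List.cons.injEq, true_and]
    have := cutFactors_take w (q :: ps) m
    simpa [List.take_succ_cons] using this

/-- The cut factors of a nondecreasing list of cut points concatenate to the factor between the
first and the last cut point. [cite: Lothaire1997, Theorem 4.1.4 (proof, p. 52)] -/
theorem flatten_cutFactors (w : List α) : ∀ (ps : List ℕ) (hps : ps ≠ []), ps.Pairwise (· ≤ ·) →
    (cutFactors w ps).flatten = (w.drop (ps.head hps)).take (ps.getLast hps - ps.head hps)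
  | [], h, _ => absurd rfl h
  | [p], _, _ => by simp [cutFactors]
  | p :: q :: ps, _, hs => by
    have hpq : p ≤ q := List.rel_of_pairwise_cons hs (by simp)
    have hs' : (q :: ps).Pairwise (· ≤ ·) := hs.of_cons
    have hql : q ≤ (q :: ps).getLast (by simp) := by
      rcases List.mem_cons.1 (List.getLast_mem (l := q :: ps) (by simp)) with h | h
      · rw [h]
      · exact List.rel_of_pairwise_cons hs' h
    rw [cutFactors, List.flatten_cons, flatten_cutFactors w (q :: ps) (by simp) hs',
      List.head_cons, List.head_cons, List.getLast_cons (a := p) (l := q :: ps) (by simp)]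
    set L := (q :: ps).getLast (by simp)
    rw [show L - p = (q - p) + (L - q) by omega, List.take_add, List.drop_drop,
      show p + (q - p) = q by omega]

/-- The cut factors between consecutive cut points inside `w` are nonempty.
[cite: Lothaire1997, Theorem 4.1.4 (proof, p. 52)] -/
theorem ne_nil_of_mem_cutFactors (w : List α) : ∀ (ps : List ℕ), ps.Pairwise (· < ·) →
    (∀ p ∈ ps, p ≤ w.length) → ∀ x ∈ cutFactors w ps, x ≠ []
  | [], _, _ => by simp [cutFactors]
  | [p], _, _ => by simp [cutFactors]
  | p :: q :: ps, hs, hle => by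
    intro x hx
    simp only [cutFactors, List.mem_cons] at hx
    rcases hx with rfl | hx
    · have hpq : p < q := List.rel_of_pairwise_cons hs (by simp)
      have hq : q ≤ w.length := hle q (by simp)
      intro h
      have := congrArg List.length h
      simp only [List.length_take, List.length_drop, List.length_nil] at this
      omega
    · exact ne_nil_of_mem_cutFactors w (q :: ps) hs.of_cons (fun r hr => hle r (by simp [hr])) x hx

/-- **Theorem 4.1.4**: let `Card(E) = n`; for each `k ≥ 1`, every word of length (at least)
`R(2, k+1, n)` contains a factor `w₁ w₂ ⋯ w_k`, `wᵢ ∈ A⁺`, with ALL the products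
`wᵢ ⋯ w_{i'}` (`1 ≤ i ≤ i' ≤ k`) of the same `φ`-value (in particular a `k`-th power modulo `φ`,
and for `k = 2`: `φ(w₁) = φ(w₂) = φ(w₁w₂)`).  The book's proof: colour the pair `{i < i'}` of
cut points by `φ(w(i, i' - 1))` and take a monochromatic `(k+1)`-set of cut points;
Ramsey's theorem enters as the hypothesis `hR`. [cite: Lothaire1997, Theorem 4.1.4] -/
theorem exists_factor_all_products_eq_of_ramsey (φ : List α → E) {k R : ℕ}
    (hR : IsRamseyPairBound (k + 1) E R) (w : List α) (hw : R ≤ w.length) :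
    ∃ ws : List (List α), ws.length = k ∧ (∀ x ∈ ws, x ≠ []) ∧ ws.flatten <:+: w ∧
      ∃ e : E, ∀ i i' : ℕ, i ≤ i' → i' < k →
        φ ((ws.drop i).take (i' + 1 - i)).flatten = e := by
  classical
  -- cut points `0, 1, …, |w|`; colour `{p < q}` by `φ (w(p+1 … q))`
  obtain ⟨Y, hY, hYk, e, he⟩ := hR (Finset.range (w.length + 1)) (by simp; omega)
    fun p q => φ ((w.drop p).take (q - p))
  set ps := Y.sort (· ≤ ·) with hps
  have hpslen : ps.length = k + 1 := by rw [hps, Finset.length_sort, hYk]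
  have hsort : ps.Pairwise (· < ·) := List.sortedLT_iff_pairwise.1 (Finset.sortedLT_sort Y)
  have hmem : ∀ p ∈ ps, p ∈ Y := fun p hp => (Finset.mem_sort _).1 hp
  have hle : ∀ p ∈ ps, p ≤ w.length := fun p hp => by
    have := Finset.mem_range.1 (hY (hmem p hp)); omega
  refine ⟨cutFactors w ps, by rw [length_cutFactors, hpslen]; rfl,
    ne_nil_of_mem_cutFactors w ps hsort hle, ?_, e, fun i i' hii' hi' => ?_⟩
  · have hne : ps ≠ [] := by intro h; rw [h] at hpslen; simp at hpslen
    rw [flatten_cutFactors w ps hne (hsort.imp fun h => le_of_lt h)]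
    exact (List.take_prefix _ _).isInfix.trans (List.drop_suffix _ _).isInfix
  · -- the product `w_{i+1} ⋯ w_{i'+1}` is the factor between cut points `ps[i]` and `ps[i'+1]`
    have hi : i < ps.length := by omega
    have hi1 : i' + 1 < ps.length := by omega
    set ps' := (ps.drop i).take (i' + 2 - i) with hps'
    have hlen' : ps'.length = i' + 2 - i := by
      rw [hps', List.length_take, List.length_drop]; omega
    have hcons : ps' = ps[i] :: (ps.drop (i + 1)).take (i' + 1 - i) := by
      rw [hps', List.drop_eq_getElem_cons hi, show i' + 2 - i = (i' + 1 - i) + 1 by omega,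
        List.take_succ_cons]
    have hne' : ps' ≠ [] := by rw [hcons]; exact List.cons_ne_nil _ _
    have hsort' : ps'.Pairwise (· < ·) :=
      (hsort.sublist (List.drop_sublist i ps)).sublist (List.take_sublist _ _)
    have hhead : ps'.head hne' = ps[i] := by
      have : ∀ (l : List ℕ) (a : ℕ) (l' : List ℕ) (h : l = a :: l') (hl : l ≠ []),
          l.head hl = a := by
        intro l a l' h hl; subst h; rfl
      exact this ps' _ _ hcons hne'
    have hlast : ps'.getLast hne' = ps[i' + 1] := by
      rw [List.getLast_eq_getElem]
      simp only [hps', List.getElem_take, List.getElem_drop, List.length_take,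
        List.length_drop]
      congr 1; omega
    rw [cutFactors_drop, cutFactors_take, show i' + 1 - i + 1 = i' + 2 - i by omega, ← hps',
      flatten_cutFactors w ps' hne' (hsort'.imp fun h => le_of_lt h), hhead, hlast]
    have hlt : ps[i] < ps[i' + 1] := List.pairwise_iff_getElem.1 hsort i (i' + 1) hi hi1 (by omega)
    exact he _ (hmem _ (List.getElem_mem hi)) _ (hmem _ (List.getElem_mem hi1)) hlt

/-- In particular (Theorem 4.1.4 ⇒ a `k`-th power modulo `φ`): under the Ramsey hypothesis every
word of length `≥ R(2, k+1, n)` contains a `k`-th power modulo `φ`.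
[cite: Lothaire1997, Theorem 4.1.4 (remark following the proof, p. 52)] -/
theorem containsPowerMod_of_ramsey (φ : List α → E) {k R : ℕ}
    (hR : IsRamseyPairBound (k + 1) E R) (w : List α) (hw : R ≤ w.length) :
    ContainsPowerMod φ k w := by
  obtain ⟨ws, hlen, hne, hinf, e, he⟩ := exists_factor_all_products_eq_of_ramsey φ hR w hw
  refine ⟨ws.flatten, hinf, ws, hlen, hne, rfl, fun x hx y hy => ?_⟩
  obtain ⟨i, hi, rfl⟩ := List.getElem_of_mem hx
  obtain ⟨j, hj, rfl⟩ := List.getElem_of_mem hy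
  have hx' := he i i le_rfl (by omega)
  have hy' := he j j le_rfl (by omega)
  rw [show i + 1 - i = 1 by omega, List.drop_eq_getElem_cons hi, List.take_succ_cons,
    List.take_zero, List.flatten_singleton] at hx'
  rw [show j + 1 - j = 1 by omega, List.drop_eq_getElem_cons hj, List.take_succ_cons,
    List.take_zero, List.flatten_singleton] at hy'
  rw [hx', hy']

/-- **Theorem 4.1.4**, unconditionally for a finite set `E` (the hypothesis of the previous
statements discharged by `exists_isRamseyPairBound`): for each `k` there is an integer `l` (an
`R(2, k+1, Card E)`) such that every word of length at least `l` contains a factor `w₁ w₂ ⋯ w_k`,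
`wᵢ ∈ A⁺`, all of whose products `wᵢ ⋯ w_{i'}` (`1 ≤ i ≤ i' ≤ k`) have the same `φ`-value.
[cite: Lothaire1997, Theorem 4.1.4] -/
theorem exists_length_factor_all_products_eq [Finite E] (φ : List α → E) (k : ℕ) :
    ∃ l : ℕ, ∀ w : List α, l ≤ w.length →
      ∃ ws : List (List α), ws.length = k ∧ (∀ x ∈ ws, x ≠ []) ∧ ws.flatten <:+: w ∧
        ∃ e : E, ∀ i i' : ℕ, i ≤ i' → i' < k →
          φ ((ws.drop i).take (i' + 1 - i)).flatten = e := by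
  obtain ⟨R, hR⟩ := exists_isRamseyPairBound (k + 1) E
  exact ⟨R, fun w hw => exists_factor_all_products_eq_of_ramsey φ hR w hw⟩

/-- Theorem 4.1.1 once more, "deduced from Ramsey's theorem" as announced in the introduction
§4.0 (p. 50): a mapping from `A⁺` to a finite set is repetitive — this time with the length
`R(2, k+1, n)` of Theorem 4.1.4 instead of `kⁿ`.
[cite: Lothaire1997, §4.0 (p. 50) and Theorem 4.1.4 (remark following the proof, p. 52)] -/
theorem isRepetitive_of_finite_ramsey [Finite E] (φ : List α → E) : IsRepetitive φ := by
  intro k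
  obtain ⟨R, hR⟩ := exists_isRamseyPairBound (k + 1) E
  exact ⟨R, fun w hw => containsPowerMod_of_ramsey φ hR w hw⟩

end Ramsey

/-! ### Example 4.1.2 — optimality of the bound `kⁿ` -/

section Example

/-- `φ(w) = max {i | aᵢ ∈ alph(w)}` for words over the letters `a₁ = 1, a₂ = 2, …` (naturals;
the empty word gets `0`). [cite: Lothaire1997, Example 4.1.2] -/
def maxLetter (w : List ℕ) : ℕ := w.foldr max 0

/-- `maxLetter` of a concatenation. [cite: Lothaire1997, Example 4.1.2] -/
theorem maxLetter_append (u v : List ℕ) : maxLetter (u ++ v) = max (maxLetter u) (maxLetter v) := by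
  induction u with
  | nil => simp [maxLetter]
  | cons a u ih =>
    simp only [maxLetter, List.cons_append, List.foldr_cons] at ih ⊢
    rw [ih, max_assoc]

/-- `maxLetter w ≤ i` iff every letter of `w` is `≤ i`. [cite: Lothaire1997, Example 4.1.2] -/
theorem maxLetter_le_iff {w : List ℕ} {i : ℕ} : maxLetter w ≤ i ↔ ∀ a ∈ w, a ≤ i := by
  induction w with
  | nil => simp [maxLetter]
  | cons a w ih =>
    simp only [maxLetter, List.foldr_cons, max_le_iff, List.mem_cons, forall_eq_or_imp] at ih ⊢
    exact and_congr_right fun _ => ih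

/-- A positive maximum is attained: if `maxLetter w = i > 0` then the letter `i` occurs in `w`.
[cite: Lothaire1997, Example 4.1.2] -/
theorem mem_of_maxLetter_eq {w : List ℕ} {i : ℕ} (h : maxLetter w = i) (hi : 0 < i) : i ∈ w := by
  induction w generalizing i with
  | nil => simp [maxLetter] at h; omega
  | cons a w ih =>
    simp only [maxLetter, List.foldr_cons] at h
    change max a (maxLetter w) = i at h
    rcases le_total a (maxLetter w) with hle | hle
    · rw [max_eq_right hle] at h
      exact List.mem_cons_of_mem a (ih h hi)
    · rw [max_eq_left hle] at h
      exact h ▸ List.mem_cons_self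

/-- The words of Example 4.1.2: `w₀ = ε`, `wᵢ = (w_{i-1} aᵢ)^{k-1} w_{i-1}` (so
`w₁ = a₁^{k-1}`), with letters `aᵢ = i`. [cite: Lothaire1997, Example 4.1.2] -/
def repFreeWord (k : ℕ) : ℕ → List ℕ
  | 0 => []
  | i + 1 => (List.replicate (k - 1) (repFreeWord k i ++ [i + 1])).flatten ++ repFreeWord k i

/-- `w₁ = a₁^{k-1}`. [cite: Lothaire1997, Example 4.1.2] -/
theorem repFreeWord_one (k : ℕ) : repFreeWord k 1 = List.replicate (k - 1) 1 := by
  simp [repFreeWord]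

/-- `|wₙ| = kⁿ - 1` (for `k ≥ 1`). [cite: Lothaire1997, Example 4.1.2] -/
theorem length_repFreeWord {k : ℕ} (hk : 1 ≤ k) (n : ℕ) :
    (repFreeWord k n).length = k ^ n - 1 := by
  induction n with
  | zero => simp [repFreeWord]
  | succ n ih =>
    simp only [repFreeWord, List.length_append, List.length_flatten, List.map_replicate,
      List.sum_replicate, smul_eq_mul, List.length_singleton, ih]
    have hkn : 1 ≤ k ^ n := Nat.one_le_pow _ _ hk
    obtain ⟨k', rfl⟩ : ∃ k', k = k' + 1 := ⟨k - 1, by omega⟩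
    simp only [Nat.add_sub_cancel, pow_succ]
    -- (k' ) * (k^n - 1 + 1) + (k^n - 1) = k^n * (k'+1) - 1
    rw [Nat.sub_add_cancel hkn]
    have : (k' + 1) ^ n * (k' + 1) = k' * (k' + 1) ^ n + (k' + 1) ^ n := by ring
    rw [this]
    omega

/-- The letters of `wₙ` lie in `{1, …, n}`. [cite: Lothaire1997, Example 4.1.2] -/
theorem mem_repFreeWord {k n a : ℕ} (h : a ∈ repFreeWord k n) : 1 ≤ a ∧ a ≤ n := by
  induction n with
  | zero => simp [repFreeWord] at h
  | succ n ih =>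
    simp only [repFreeWord, List.mem_append, List.mem_flatten, List.mem_replicate] at h
    rcases h with ⟨l, ⟨-, rfl⟩, h⟩ | h
    · rcases List.mem_append.1 h with h | h
      · have := ih h; omega
      · simp at h; omega
    · have := ih h; omega

/-- The letter `aₙ` occurs exactly `k - 1` times in `wₙ` (`n ≥ 1`).
[cite: Lothaire1997, Example 4.1.2] -/
theorem count_repFreeWord_self (k n : ℕ) : (repFreeWord k (n + 1)).count (n + 1) = k - 1 := by
  have h0 : (repFreeWord k n).count (n + 1) = 0 :=
    List.count_eq_zero.2 fun h => by have := mem_repFreeWord h; omega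
  simp [repFreeWord, List.count_append, List.count_flatten, List.map_replicate, List.sum_replicate,
    h0]

/-- [folklore] A factor of `x c y` avoiding the separating letter `c` lies in one of the two
sides (used for Example 4.1.2). -/
private theorem infix_append_cons_of_not_mem {v x y : List ℕ} {c : ℕ} (h : v <:+: x ++ c :: y)
    (hc : c ∉ v) : v <:+: x ∨ v <:+: y := by
  obtain ⟨s, t, hst⟩ := h
  have hv : v = ((x ++ c :: y).drop s.length).take v.length := by
    rw [← hst, List.append_assoc, List.drop_left, List.take_left]
  by_cases h1 : s.length + v.length ≤ x.length
  · left
    rw [List.drop_append_of_le_length (by omega), List.take_append_of_le_length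
      (by rw [List.length_drop]; omega)] at hv
    rw [hv]
    exact (List.take_prefix _ _).isInfix.trans (List.drop_suffix _ _).isInfix
  by_cases h2 : x.length + 1 ≤ s.length
  · right
    have hx : x ++ c :: y = (x ++ [c]) ++ y := by simp
    rw [hx, List.drop_append, List.drop_eq_nil_of_le (by simp; omega),
      List.nil_append, List.length_append, List.length_singleton] at hv
    rw [hv]
    exact (List.take_prefix _ _).isInfix.trans (List.drop_suffix _ _).isInfix
  · exfalso
    apply hc
    rw [hv, List.drop_append_of_le_length (by omega), List.take_append,
      List.length_drop]
    refine List.mem_append_right _ ?_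
    obtain ⟨m, hm⟩ : ∃ m, v.length - (x.length - s.length) = m + 1 :=
      ⟨v.length - (x.length - s.length) - 1, by omega⟩
    rw [hm, List.take_succ_cons]
    exact List.mem_cons_self

/-- A factor of `(x c)^m x` avoiding the letter `c` is a factor of `x` (the inductive step of
Example 4.1.2). [cite: Lothaire1997, Example 4.1.2] -/
private theorem infix_of_infix_blocks {v x : List ℕ} {c : ℕ} (m : ℕ)
    (h : v <:+: (List.replicate m (x ++ [c])).flatten ++ x) (hc : c ∉ v) : v <:+: x := by
  induction m with
  | zero => simpa using h
  | succ m ih =>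
    have heq : (List.replicate (m + 1) (x ++ [c])).flatten ++ x =
        x ++ c :: ((List.replicate m (x ++ [c])).flatten ++ x) := by
      simp [List.replicate_succ, List.append_assoc]
    rw [heq] at h
    rcases infix_append_cons_of_not_mem h hc with h | h
    · exact h
    · exact ih h

/-- **Example 4.1.2**: `wₙ` contains no `k`-th power modulo `φ = maxLetter` (`k ≥ 1`).  Proof: a
`k`-th power of common value `j = n` would need `k` occurrences of `aₙ` (there are `k - 1`); one
of value `j < n` avoids `aₙ`, hence sits inside a copy of `w_{n-1}` — induction.
[cite: Lothaire1997, Example 4.1.2] -/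
theorem not_containsPowerMod_repFreeWord {k : ℕ} (hk : 1 ≤ k) (n : ℕ) :
    ¬ ContainsPowerMod maxLetter k (repFreeWord k n) := by
  induction n with
  | zero =>
    rintro ⟨v, hv, ws, hlen, hne, hflat, -⟩
    simp only [repFreeWord, List.infix_nil] at hv
    subst hv
    have h0 : ws = [] := by
      by_contra h
      obtain ⟨x, hx⟩ := List.exists_mem_of_ne_nil ws h
      have := length_le_length_flatten_of_ne_nil hne
      rw [hflat] at this
      simp at this
      rw [this] at hx
      simp at hx
    subst h0
    simp at hlen
    omega
  | succ n ih =>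
    rintro ⟨v, hv, ws, hlen, hne, hflat, hφ⟩
    have hk' : ws ≠ [] := by
      intro h; subst h; simp at hlen; omega
    obtain ⟨x₀, hx₀⟩ := List.exists_mem_of_ne_nil ws hk'
    set j := maxLetter x₀ with hj
    have hφj : ∀ x ∈ ws, maxLetter x = j := fun x hx => hφ x hx x₀ hx₀
    -- letters of `v` are in `{1, …, n+1}`
    have hletters : ∀ a ∈ v, 1 ≤ a ∧ a ≤ n + 1 := fun a ha =>
      mem_repFreeWord (hv.subset ha)
    by_cases hjn : j = n + 1
    · -- every component contains the letter `n+1`: too many occurrences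
      have hmem : ∀ x ∈ ws, n + 1 ∈ x := fun x hx =>
        mem_of_maxLetter_eq ((hφj x hx).trans hjn) (Nat.succ_pos n)
      have hcount : k ≤ v.count (n + 1) := by
        rw [← hflat, List.count_flatten, ← hlen]
        have : ∀ x ∈ ws, 1 ≤ x.count (n + 1) := fun x hx =>
          List.count_pos_iff.2 (hmem x hx)
        -- sum of ≥ 1 terms over `ws`
        clear hflat hφ hφj hmem hx₀ hk' hlen hne
        induction ws with
        | nil => simp
        | cons x ws ih' =>
          simp only [List.map_cons, List.sum_cons, List.length_cons]
          have h1 := this x (by simp)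
          have h2 := ih' (fun y hy => this y (by simp [hy]))
          omega
      have hle : v.count (n + 1) ≤ (repFreeWord k (n + 1)).count (n + 1) :=
        hv.sublist.count_le _
      rw [count_repFreeWord_self] at hle
      omega
    · -- `j ≤ n`: no component contains `n+1`, so `v` avoids it and sits inside a `wₙ` block
      have hjle : j ≤ n := by
        have : j ≤ n + 1 := by
          rw [hj, maxLetter_le_iff]
          intro a ha
          exact (hletters a (hflat ▸ List.mem_flatten.2 ⟨x₀, hx₀, ha⟩)).2
        omega
      have hnot : n + 1 ∉ v := by
        intro hmem
        rw [← hflat, List.mem_flatten] at hmem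
        obtain ⟨x, hx, hnx⟩ := hmem
        have := maxLetter_le_iff.1 (le_of_eq (hφj x hx)) (n + 1) hnx
        omega
      have hvx : v <:+: repFreeWord k n := infix_of_infix_blocks (k - 1) hv hnot
      exact ih ⟨v, hvx, ws, hlen, hne, hflat, hφ⟩

/-- **Example 4.1.2, packaged**: for every `k ≥ 1` and `n` there is a word of length `kⁿ - 1`
over the `n` letters `{1, …, n}` — on whose nonempty factors `φ = maxLetter` takes only the `n`
values `{1, …, n}` — containing no `k`-th power modulo `φ`; so the bound `kⁿ` in
Theorem 4.1.1 is optimal. [cite: Lothaire1997, Example 4.1.2] -/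
theorem exists_long_word_without_powerMod {k : ℕ} (hk : 1 ≤ k) (n : ℕ) :
    ∃ w : List ℕ, w.length = k ^ n - 1 ∧ (∀ a ∈ w, 1 ≤ a ∧ a ≤ n) ∧
      (∀ v, v <:+: w → v ≠ [] → 1 ≤ maxLetter v ∧ maxLetter v ≤ n) ∧
      ¬ ContainsPowerMod maxLetter k w := by
  refine ⟨repFreeWord k n, length_repFreeWord hk n, fun a ha => mem_repFreeWord ha,
    fun v hv hne => ⟨?_, maxLetter_le_iff.2 fun a ha => (mem_repFreeWord (hv.subset ha)).2⟩,
    not_containsPowerMod_repFreeWord hk n⟩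
  obtain ⟨a, ha⟩ := List.exists_mem_of_ne_nil v hne
  have h1 : 1 ≤ a := (mem_repFreeWord (hv.subset ha)).1
  by_contra h0
  have : maxLetter v ≤ 0 := by omega
  have := maxLetter_le_iff.1 this a ha
  omega

/-- Small instances of Example 4.1.2 checked by computation: `w₂` for `k = 2` is `a₁ a₂ a₁`
and `w₂` for `k = 3` is `a₁a₁a₂a₁a₁a₂a₁a₁` (lengths `2² - 1`, `3² - 1`).
[cite: Lothaire1997, Example 4.1.2] -/
theorem repFreeWord_small :
    repFreeWord 2 2 = [1, 2, 1] ∧ repFreeWord 3 2 = [1, 1, 2, 1, 1, 2, 1, 1] := by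
  constructor <;> decide

end Example

end Literature.Combinatorics.Words
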